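import Summits.Ventures.PercRepro.ProfilePointedCircuitClassesFiveLYM
import Summits.Ventures.PercRepro.ProfilePointedCircuitClassesFiveOne
import Summits.Ventures.PercRepro.ProfilePointedCircuitClassesFiveTwo

/-!
# PercRepro — THE BOTTOM-LEVEL PER-CIRCUIT CLAIM AT NULLITY 5, VII: THE ASSEMBLY — THE CO-RANK-6 TOP THRESHOLD AT
NULLITY `≤ 5` MODULO THE PER-POINT IN–OUT INEQUALITY AT NULLITY 4 (p5, gen 37; `proofs/P5-GM1.md` §53)

The class `#C = 3` (the LYM counting with `local_lym_five_of_card_eq_three`), the case split over the size of the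
class (`gammaC_five_le_of_nullity_five_of_inout`: `#C ≥ 6` empty, `5`, `4`, `3` unconditional, `2` modulo
`InOutBottomFour`, `1` the nullity-4 bridge, `0` empty), the per-point form `κ_5 ≤ κ_{n−6}` and `out_5 ≤ in_6`,
Theorem A's step `(n − 5)·P_5 ≤ 6·P_6` on nullity `5`, and THE CO-RANK-6 TOP THRESHOLD
`thresholdIneq_six_top_of_nullity_le_five_of_inout` — all modulo the single CONJECTURE def `InOutBottomFour`
(`in_4(e) ≤ out_5(e)` at the bottom of nullity `4`, census-true, §53(b)–(d)), which is the only open piece.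
-/

open scoped Matroid

namespace PercRepro.Cogirth

open Finset ThmH Skew Shadow Profile

variable {α : Type} [DecidableEq α] {N : Matroid α} [N.Finite]

section FiveTop

/-- Every demand of a class whose circuit captures `x` has a unit above it: a basis `J ⊇ W` of `E − x` minus a
point of `J ∖ W` (the construction of `gammaC_four_le_of_card_eq_four`, for a general class `C` with
`x ∈ cl C`). -/
theorem exists_unit_superset_five (hn : (gr N).card = rk N (gr N) + 5) (hR : 7 ≤ rk N (gr N)) {x : α}
    {C W : Finset α} (hW : W ∈ (biIndepSets N 5).filter (fun W => x ∉ W ∧ x ∈ clF N W ∧ fundC N W x = C))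
    (hxC : x ∈ clF N C) :
    ∃ V ∈ (biIndepSets N ((gr N).card - 6)).filter (fun V => x ∉ V ∧ x ∈ clF N V ∧ fundC N V x = C), W ⊆ V := by
  rw [mem_filter, mem_biIndepSets] at hW
  obtain ⟨⟨hWg, hWcard, hWrk, hWcompl⟩, hxW, hxcl, hfund⟩ := hW
  obtain ⟨J, hWJ, hJE, hJrk, hJcard⟩ := exists_indep_erase_superset_card_rk hWg hWrk hxW hxcl
  have hJg : J ⊆ gr N := hJE.trans (erase_subset _ _)
  have hxJ : x ∉ J := fun h => (mem_erase.1 (hJE h)).1 rfl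
  obtain ⟨u, huJ, huW⟩ := exists_mem_notMem_of_card_lt_card (show W.card < J.card by omega)
  have hWV : W ⊆ J.erase u := by
    intro w hw
    rw [mem_erase]
    exact ⟨fun h => huW (h ▸ hw), hWJ hw⟩
  have hVg : J.erase u ⊆ gr N := (erase_subset _ _).trans hJg
  have hVrk : rk N (J.erase u) = (J.erase u).card := rk_eq_card_of_subset_of_rk_eq_card (erase_subset _ _) hJrk
  have hxV : x ∉ J.erase u := fun h => hxJ (erase_subset _ _ h)
  have hxclV : x ∈ clF N (J.erase u) := mem_clF_of_subset hWV hxcl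
  refine ⟨J.erase u, ?_, hWV⟩
  rw [mem_filter, mem_biIndepSets]
  refine ⟨⟨hVg, ?_, hVrk, ?_⟩, hxV, hxclV, ?_⟩
  · rw [card_erase_of_mem huJ, hJcard]
    omega
  · exact rk_eq_card_of_subset_of_rk_eq_card (sdiff_subset_sdiff (Subset.refl _) hWV) hWcompl
  · exact fundC_eq_of_subset hWg hWrk hxcl hfund hxC hWV hVg hVrk hxclV


/-- THE CLASS `#C = 3` AT NULLITY 5 (`#(C ∪ x) = 4`, the two-free-point class; §53(e)): the LYM counting on the
containment graph of the class, with `local_lym_five_of_card_eq_three` on every edge. -/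
theorem gammaC_five_le_of_card_eq_three (hn : (gr N).card = rk N (gr N) + 5) (hR : 7 ≤ rk N (gr N))
    (x : α) {C : Finset α} (hC : C.card = 3) : gammaC N 5 x C ≤ gammaC N ((gr N).card - 6) x C := by
  unfold gammaC
  apply card_le_card_of_lym
  · intro W hW
    have hW' := hW
    rw [mem_filter, mem_biIndepSets] at hW'
    obtain ⟨⟨hWg, hWcard, hWrk, hWcompl⟩, hxW, hxcl, hfund⟩ := hW'
    have hxg : x ∈ gr N := clF_subset_gr W hxcl
    have hCW : C ⊆ W := hfund ▸ fundC_subset W x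
    have hxC : x ∈ clF N C := by
      have h := mem_clF_sdiff_of_forall_notMem_fundC hxg hWg hWrk hxcl (W \ C) sdiff_subset
        (fun w hw => by rw [hfund]; exact (mem_sdiff.1 hw).2)
      rwa [Finset.sdiff_sdiff_eq_self hCW] at h
    exact exists_unit_superset_five hn hR hW hxC
  · intro W hW V hV hWV
    exact local_lym_five_of_card_eq_three hn hR x hC hW hV hWV

/-- **THE BOTTOM-LEVEL PER-CIRCUIT CLAIM AT NULLITY 5 MODULO THE IN–OUT INEQUALITY AT NULLITY 4** (§53): on a matroid
with `#E = ρ(E) + 5` and `ρ(E) ≥ 7`, every circuit class has at least as many captured sets at the level `n − 6` as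
at the level `5` — by cases on the size of the class: `#C ≥ 6` empty, `#C = 5` (`Δ ≤ 1 ≤ U`), `#C = 4` (the uniform
bound `ρ − 5`), `#C = 3` (the local LYM), `#C = 2` (the in–out inequality on `N ／ x ∖ w₁`), `#C = 1` (the nullity-4
step on `N ／ w ∖ x`), `#C = 0` empty. -/
theorem gammaC_five_le_of_nullity_five_of_inout (hio : InOutBottomFour α)
    (hn : (gr N).card = rk N (gr N) + 5) (hR : 7 ≤ rk N (gr N))
    (x : α) (C : Finset α) : gammaC N 5 x C ≤ gammaC N ((gr N).card - 6) x C := by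
  rcases Nat.lt_or_ge 5 C.card with h6 | h5
  · rw [gammaC_eq_zero_of_lt_card h6]
    exact Nat.zero_le _
  · by_cases hx : x ∈ gr N
    · interval_cases hc : C.card
      · rw [gammaC_eq_zero_of_card_eq_zero hc (by norm_num) hx]
        exact Nat.zero_le _
      · exact gammaC_five_le_of_card_eq_one hn hR x hc
      · exact gammaC_five_le_of_card_eq_two_of_inout hio hn hR x hc
      · exact gammaC_five_le_of_card_eq_three hn hR x hc
      · exact gammaC_five_le_of_card_eq_four hn hR x hc
      · exact gammaC_five_le_of_card_eq_five hn hR x hc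
    · have h0 : gammaC N 5 x C = 0 := by
        unfold gammaC
        rw [card_eq_zero, filter_eq_empty_iff]
        intro W _ hWC
        exact hx (clF_subset_gr W hWC.2.1)
      rw [h0]
      exact Nat.zero_le _

/-- `κ_5(x) ≤ κ_{n−6}(x)` on every matroid of nullity `5` and rank `≥ 7`, modulo `InOutBottomFour` — the per-point
form `(C_x)` of Theorem A at the level `5`, summed over the circuit classes. -/
theorem capCount_five_le_of_nullity_five_of_inout (hio : InOutBottomFour α)
    (hn : (gr N).card = rk N (gr N) + 5) (hR : 7 ≤ rk N (gr N))
    (x : α) : capCount N 5 x ≤ capCount N ((gr N).card - 6) x := by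
  rw [capCount_eq_sum_gammaC, capCount_eq_sum_gammaC]
  exact sum_le_sum (fun C _ => gammaC_five_le_of_nullity_five_of_inout hio hn hR x C)

/-- `out_5(x) ≤ in_6(x)` on every matroid of nullity `5` and rank `≥ 7`, modulo `InOutBottomFour` (the mirror
identity `outCount_add_capCount_mirror` with `capCount_five_le_of_nullity_five_of_inout`). -/
theorem outCount_five_le_inCount_six_of_nullity_five_of_inout (hio : InOutBottomFour α)
    (hn : (gr N).card = rk N (gr N) + 5) (hR : 7 ≤ rk N (gr N)) {x : α} (hx : x ∈ gr N) :
    outCount N 5 x ≤ inCount N 6 x := by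
  have h := outCount_add_capCount_mirror (M := N) 5 hx (by omega)
  have h2 := capCount_five_le_of_nullity_five_of_inout hio hn hR x
  norm_num at h
  omega

/-- **THEOREM A'S STEP AT THE LEVEL `5` ON EVERY MATROID OF NULLITY `5` AND RANK `≥ 7`, MODULO THE IN–OUT INEQUALITY AT
NULLITY 4**: `(n − 5)·P_5 ≤ 6·P_6` (§53(e)). -/
theorem biIndep_step_five_of_nullity_five_of_inout (hio : InOutBottomFour α)
    (hn : (gr N).card = rk N (gr N) + 5) (hR : 7 ≤ rk N (gr N)) :
    ((gr N).card - 5) * (biIndepSets N 5).card ≤ 6 * (biIndepSets N 6).card := by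
  rw [← sum_outCount, ← sum_inCount]
  exact sum_le_sum (fun x hx => outCount_five_le_inCount_six_of_nullity_five_of_inout hio hn hR hx)

/-- `(I_{ρ−1})` at co-rank `6` on `#E = ρ(E) + 5` from the step alone (the body of
`thresholdIneq_of_card_eq_of_unimodal` with the single instance `biIndep_step_five_of_nullity_five_of_inout`). -/
theorem thresholdIneq_six_top_of_card_eq_of_inout (hio : InOutBottomFour α)
    (hn : (gr N).card = rk N (gr N) + 5) (hR : 7 ≤ rk N (gr N)) :
    ThresholdIneq N 6 (rk N (gr N) - 1) := by
  have hn' : (gr N).card = (rk N (gr N) - 1) + 6 := by omega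
  unfold ThresholdIneq
  rw [thresholdSum_of_card_eq hn' (by norm_num), levelSetCoQ_eq_biIndepSets_of_card_eq hn']
  have h := biIndep_step_five_of_nullity_five_of_inout hio hn hR
  have e1 : (gr N).card - 5 = (rk N (gr N) - 1) + 1 := by omega
  rw [e1] at h
  exact h

/-- **THE CO-RANK-6 TOP THRESHOLD ON EVERY FINITE MATROID WITH AT MOST FIVE MORE POINTS THAN ITS RANK (RANK `≥ 6`),
MODULO THE PER-POINT IN–OUT INEQUALITY AT THE BOTTOM OF NULLITY 4** (`InOutBottomFour`, §53): nullity `≤ 4` is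
vacuous, rank `6` is the trivial row, nullity `5` at rank `≥ 7` is `biIndep_step_five_of_nullity_five_of_inout`.
The only class of the nullity-5 per-circuit claim that is not proved outright is `#C = 2`; everything else is
unconditional. -/
theorem thresholdIneq_six_top_of_nullity_le_five_of_inout (hio : InOutBottomFour α)
    (hn : (gr N).card ≤ rk N (gr N) + 5) (hR : 6 ≤ rk N (gr N)) :
    ThresholdIneq N 6 (rk N (gr N) - 1) := by
  by_cases hlow : (gr N).card + 2 ≤ rk N (gr N) + 6
  · exact thresholdIneq_top_of_card_add_two_le (by norm_num) hlow
  · by_cases hRq : rk N (gr N) = 6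
    · exact thresholdIneq_top_of_rk_eq (by norm_num) hRq
    · exact thresholdIneq_six_top_of_card_eq_of_inout hio (by omega) (by omega)

end FiveTop

end PercRepro.Cogirth
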